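import Mathlib
import Summits.CriticalPhenomena.PercolationContinuityZ3.Theorems.PercNearOneGluingNoHeavyLowerTailOrderedDifferencesPencil
import Summits.CriticalPhenomena.PercolationContinuityZ3.Theorems.PercNearOneGluingNoHeavyLowerTailOrderedDifferencesTwoChain

/-!
# A pencil dependency takes at least three values (characteristic 0)

Helper file for crux `stmt-CriticalPhenomena-4575` (`NoHeavyLowerTail`, route `PercNearOneGluingNoHeavy`), new-inequality factory
seat `prim-ineq-gen-3` (gen 27).  Everything here is PROVED; no definitions.

Notation (memo `run/shared/lean/prim/prim-ineq-gen-3/FINDINGS-gen27.md`): for a finite family `𝒜` with difference family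
`D = 𝒜 \\ 𝒜` the PENCIL rows are `A ↦ (E ↦ [E ⊆ A] + t·[E ∩ A = ∅])`, and a DEPENDENCY at `t` is a coefficient vector `c` with
`∑_A c_A ([E ⊆ A] + t [E ∩ A = ∅]) = 0` for every `E ∈ D`.  CONJECTURE (C0) says there is none for `t ∉ {0, ±1}` in characteristic 0.

The gen-27 type-space census found that every pencil dependency in characteristic `p` among families with at most 8 members (the Fano
plane mod 7, the `K_{3,4}`-type families mod 5, …) has a coefficient vector that is CONSTANT ON TWO CLASSES of members.  This file
shows why such 'two-class mechanisms' never lift to characteristic 0: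

* `pencil_dependency_eq_zero_of_two_valued` — over a field of characteristic 0, for `t ≠ ±1`, a dependency `c` of the pencil rows
  over `𝒜 \\ 𝒜` that takes at most two values is zero.  [The `∅`-column gives `∑ c = 0`, so `c` is a scalar multiple of the rational
  vector `(n₂ on one class, −n₁ on the other)`; by the Marica–Schönheim rank theorem some column then forces `t ∈ ℚ`, and the rational
  pencil theorem `linearIndependent_pencil_diffs` (gen 20) finishes.]

So every would-be counterexample to (C0) needs at least three distinct coefficients (prim-ineq-gen-3 gen 27, 2026-08-25).
-/

namespace Summit.CriticalPhenomena.PercolationContinuityZ3.Theorems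

namespace OrderedDifferences

open Finset
open scoped FinsetFamily

variable {α : Type*} [DecidableEq α] {K : Type*} [Field K] [CharZero K]

/-- **A pencil dependency is at least three-valued.**  Let `K` be a field of characteristic zero, `t ∈ K` with `t ≠ ±1`, and let
`c : 𝒜 → K` satisfy `∑_A c_A ([E ⊆ A] + t·[E ∩ A = ∅]) = 0` for every `E ∈ 𝒜 \\ 𝒜`.  If `c` takes at most two values then `c = 0`. -/
theorem pencil_dependency_eq_zero_of_two_valued (𝒜 : Finset (Finset α)) {t : K} (ht1 : t ≠ 1) (ht2 : t ≠ -1)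
    (c : ↥𝒜 → K)
    (hdep : ∀ E ∈ 𝒜 \\ 𝒜, ∑ A : 𝒜, c A * ((if E ⊆ (A : Finset α) then (1 : K) else 0) +
        t * (if Disjoint E (A : Finset α) then (1 : K) else 0)) = 0)
    (x y : K) (hxy : ∀ A : 𝒜, c A = x ∨ c A = y) : c = 0 := by
  classical
  -- trivial if the family is empty
  rcases 𝒜.eq_empty_or_nonempty with h0 | ⟨A0, hA0⟩
  · subst h0
    funext A
    exact absurd A.2 (Finset.notMem_empty _)
  -- the ∅ column: ∑ c = 0
  have hD : ∀ A ∈ 𝒜, ∀ B ∈ 𝒜, A \ B ∈ 𝒜 \\ 𝒜 := fun A hA B hB => mem_diffs.mpr ⟨A, hA, B, hB, rfl⟩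
  have hempty : (∅ : Finset α) ∈ 𝒜 \\ 𝒜 := by simpa using hD A0 hA0 A0 hA0
  have hsum : ∑ A : 𝒜, c A = 0 := by
    have h := hdep ∅ hempty
    have e : ∑ A : 𝒜, c A * ((if (∅ : Finset α) ⊆ (A : Finset α) then (1 : K) else 0) +
        t * (if Disjoint (∅ : Finset α) (A : Finset α) then (1 : K) else 0)) = (1 + t) * ∑ A : 𝒜, c A := by
      rw [mul_sum]
      refine sum_congr rfl fun A _ => ?_
      simp only [empty_subset, if_true, disjoint_empty_left]
      ring
    rw [e] at h
    have h1t : (1 + t) ≠ 0 := fun h1 => ht2 (by linear_combination h1)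
    exact (mul_eq_zero.mp h).resolve_left h1t
  -- the two classes and their sizes
  set n1 : ℕ := #(univ.filter fun A : 𝒜 => c A = x) with hn1
  set n2 : ℕ := #(univ.filter fun A : 𝒜 => ¬ c A = x) with hn2
  have hrel : (n1 : K) * x + (n2 : K) * y = 0 := by
    rw [← hsum, ← sum_filter_add_sum_filter_not univ (fun A : 𝒜 => c A = x)]
    have e1 : ∑ A ∈ univ.filter (fun A : 𝒜 => c A = x), c A = (n1 : K) * x := by
      rw [sum_congr rfl (fun A hA => (mem_filter.mp hA).2), sum_const, nsmul_eq_mul]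
    have e2 : ∑ A ∈ univ.filter (fun A : 𝒜 => ¬ c A = x), c A = (n2 : K) * y := by
      rw [sum_congr rfl (fun A hA => ((hxy A).resolve_left (mem_filter.mp hA).2)), sum_const, nsmul_eq_mul]
    rw [e1, e2]
  -- if one class is empty, `c` is constant with sum zero, hence zero
  have hconst : ∀ z : K, (∀ A : 𝒜, c A = z) → c = 0 := by
    intro z hz
    have hs : ∑ A : 𝒜, c A = (Fintype.card ↥𝒜 : K) * z := by
      rw [sum_congr rfl (fun A _ => hz A), sum_const, nsmul_eq_mul, card_univ]
    have hcard : (Fintype.card ↥𝒜 : K) ≠ 0 := by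
      have : 0 < Fintype.card ↥𝒜 := Fintype.card_pos_iff.mpr ⟨⟨A0, hA0⟩⟩
      exact_mod_cast this.ne'
    have hz0 : z = 0 := (mul_eq_zero.mp (hs ▸ hsum : (Fintype.card ↥𝒜 : K) * z = 0)).resolve_left hcard
    funext A
    rw [hz A, hz0, Pi.zero_apply]
  by_cases hn20 : n2 = 0
  · refine hconst x fun A => ?_
    by_contra hA
    have hmem : A ∈ univ.filter (fun B : 𝒜 => ¬ c B = x) := mem_filter.mpr ⟨mem_univ _, hA⟩
    have hcard : #(univ.filter fun B : 𝒜 => ¬ c B = x) = 0 := hn2 ▸ hn20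
    rw [card_eq_zero.mp hcard] at hmem
    exact Finset.notMem_empty _ hmem
  by_cases hn10 : n1 = 0
  · refine hconst y fun A => (hxy A).resolve_left fun hA => ?_
    have hmem : A ∈ univ.filter (fun B : 𝒜 => c B = x) := mem_filter.mpr ⟨mem_univ _, hA⟩
    have hcard : #(univ.filter fun B : 𝒜 => c B = x) = 0 := hn1 ▸ hn10
    rw [card_eq_zero.mp hcard] at hmem
    exact Finset.notMem_empty _ hmem
  have hn1K : (n1 : K) ≠ 0 := by exact_mod_cast hn10
  have hn2K : (n2 : K) ≠ 0 := by exact_mod_cast hn20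
  -- if x = 0 then n2 * y = 0, so y = 0 and c = 0
  by_cases hx0 : x = 0
  · have hy0 : y = 0 := by
      have h : (n2 : K) * y = 0 := by
        have := hrel
        rw [hx0, mul_zero, zero_add] at this
        exact this
      exact (mul_eq_zero.mp h).resolve_left hn2K
    funext A
    rcases hxy A with h | h
    · rw [h, hx0, Pi.zero_apply]
    · rw [h, hy0, Pi.zero_apply]
  -- main case: the rational shadow c0 = (n2 on the x-class, -n1 on the y-class); n2 • c = x • c0
  let c0 : ↥𝒜 → ℚ := fun A => if c A = x then (n2 : ℚ) else -(n1 : ℚ)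
  have hc0 : ∀ A : 𝒜, (n2 : K) * c A = x * ((c0 A : ℚ) : K) := by
    intro A
    by_cases hA : c A = x
    · simp only [c0, hA, if_true, Rat.cast_natCast]; ring
    · have hy : c A = y := (hxy A).resolve_left hA
      have e0 : c0 A = -(n1 : ℚ) := by simp only [c0, if_neg hA]
      rw [e0, hy, Rat.cast_neg, Rat.cast_natCast]
      linear_combination hrel
  have hc0ne : c0 ≠ 0 := by
    intro h
    have h' := congr_fun h ⟨A0, hA0⟩
    simp only [c0, Pi.zero_apply] at h'
    by_cases hA : c ⟨A0, hA0⟩ = x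
    · rw [if_pos hA] at h'
      exact hn20 (by exact_mod_cast h')
    · rw [if_neg hA, neg_eq_zero] at h'
      exact hn10 (by exact_mod_cast h')
  -- casting `if` through ℚ → K
  have castite : ∀ (P : Prop) [Decidable P], (((if P then (1 : ℚ) else 0 : ℚ)) : K) = if P then (1 : K) else 0 := by
    intro P _
    split_ifs <;> simp
  -- rational column sums of c0
  let a : Finset α → ℚ := fun E => ∑ A : 𝒜, c0 A * (if E ⊆ (A : Finset α) then (1 : ℚ) else 0)
  let b : Finset α → ℚ := fun E => ∑ A : 𝒜, c0 A * (if Disjoint E (A : Finset α) then (1 : ℚ) else 0)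
  have hcast_a : ∀ E, ((a E : ℚ) : K) = ∑ A : 𝒜, ((c0 A : ℚ) : K) * (if E ⊆ (A : Finset α) then (1 : K) else 0) := by
    intro E
    simp only [a, Rat.cast_sum, Rat.cast_mul, castite]
  have hcast_b : ∀ E, ((b E : ℚ) : K) = ∑ A : 𝒜, ((c0 A : ℚ) : K) * (if Disjoint E (A : Finset α) then (1 : K) else 0) := by
    intro E
    simp only [b, Rat.cast_sum, Rat.cast_mul, castite]
  have hab : ∀ E ∈ 𝒜 \\ 𝒜, ((a E : ℚ) : K) + t * ((b E : ℚ) : K) = 0 := by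
    intro E hE
    have h := hdep E hE
    have e1 : ((a E : ℚ) : K) + t * ((b E : ℚ) : K) =
        ∑ A : 𝒜, ((c0 A : ℚ) : K) * ((if E ⊆ (A : Finset α) then (1 : K) else 0) +
          t * (if Disjoint E (A : Finset α) then (1 : K) else 0)) := by
      rw [hcast_a, hcast_b, mul_sum, ← sum_add_distrib]
      refine sum_congr rfl fun A _ => ?_
      ring
    have e2 : x * ∑ A : 𝒜, ((c0 A : ℚ) : K) * ((if E ⊆ (A : Finset α) then (1 : K) else 0) +
          t * (if Disjoint E (A : Finset α) then (1 : K) else 0)) =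
        (n2 : K) * ∑ A : 𝒜, c A * ((if E ⊆ (A : Finset α) then (1 : K) else 0) +
          t * (if Disjoint E (A : Finset α) then (1 : K) else 0)) := by
      rw [mul_sum, mul_sum]
      refine sum_congr rfl fun A _ => ?_
      have := hc0 A
      linear_combination (-((if E ⊆ (A : Finset α) then (1 : K) else 0) +
        t * (if Disjoint E (A : Finset α) then (1 : K) else 0))) * this
    have h2 : x * (((a E : ℚ) : K) + t * ((b E : ℚ) : K)) = 0 := by rw [e1, e2, h, mul_zero]
    exact (mul_eq_zero.mp h2).resolve_left hx0
  -- Marica–Schönheim over ℚ: some column has a E ≠ 0 (since c0 ≠ 0)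
  have hexists : ∃ E ∈ 𝒜 \\ 𝒜, a E ≠ 0 := by
    by_contra hno
    refine hc0ne (eq_zero_of_sum_incidence_diffs_eq_zero (K := ℚ) 𝒜 c0 fun F hF => ?_)
    by_contra haF
    exact hno ⟨F, hF, haF⟩
  obtain ⟨E, hE, haE⟩ := hexists
  have hbE : b E ≠ 0 := by
    intro hb
    have h := hab E hE
    rw [hb, Rat.cast_zero, mul_zero, add_zero] at h
    exact haE (by exact_mod_cast h)
  -- hence t is rational: t = q := -a E / b E
  set q : ℚ := -a E / b E with hq
  have htq : t = ((q : ℚ) : K) := by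
    have h := hab E hE
    have hbK : ((b E : ℚ) : K) ≠ 0 := by exact_mod_cast hbE
    rw [hq, Rat.cast_div, Rat.cast_neg]
    field_simp
    linear_combination h
  have hq1 : q ≠ 1 := by
    intro h; apply ht1; rw [htq, h, Rat.cast_one]
  have hq2 : q ≠ -1 := by
    intro h; apply ht2; rw [htq, h, Rat.cast_neg, Rat.cast_one]
  -- c0 is then a rational dependency at the rational parameter q
  have hdepQ : ∀ F ∈ 𝒜 \\ 𝒜, a F + q * b F = 0 := by
    intro F hF
    have h := hab F hF
    rw [htq, ← Rat.cast_mul, ← Rat.cast_add] at h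
    exact_mod_cast h
  -- contradiction with the rational pencil theorem
  have hli := linearIndependent_pencil_diffs 𝒜 hq1 hq2
  rw [Fintype.linearIndependent_iff] at hli
  have hzero : c0 = 0 := by
    funext A
    refine hli c0 ?_ A
    funext F
    simp only [Finset.sum_apply, Pi.smul_apply, smul_eq_mul, Pi.zero_apply]
    have h := hdepQ F F.2
    have e : ∑ A : 𝒜, c0 A * ((if (F : Finset α) ⊆ (A : Finset α) then (1 : ℚ) else 0) +
        q * (if Disjoint (F : Finset α) (A : Finset α) then (1 : ℚ) else 0)) = a F + q * b F := by
      simp only [a, b, mul_sum, ← sum_add_distrib]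
      refine sum_congr rfl fun A _ => ?_
      ring
    rw [e, h]
  exact absurd hzero hc0ne

/-- **A pencil dependency is never proportional to a rational vector.**  Let `K` be a field of characteristic zero, `t ∈ K` with `t ≠ ±1`, and let
`c : 𝒜 → K` satisfy `∑_A c_A ([E ⊆ A] + t·[E ∩ A = ∅]) = 0` for every `E ∈ 𝒜 \\ 𝒜`.  If `c = x • c₀` for a scalar `x ∈ K` and a RATIONAL vector `c₀`,
then `c = 0`.  [By the Marica–Schönheim rank theorem some column of `c₀` has a non-zero containment sum, which forces `t ∈ ℚ`; then the rational
pencil theorem `linearIndependent_pencil_diffs` applies to `c₀`.]  In particular the coefficient vector of a minimal counterexample to (C0) spans a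
`ℚ`-vector space of dimension ≥ 2 (gen 27). -/
theorem pencil_dependency_eq_zero_of_rat_smul (𝒜 : Finset (Finset α)) {t : K} (ht1 : t ≠ 1) (ht2 : t ≠ -1)
    (c : ↥𝒜 → K)
    (hdep : ∀ E ∈ 𝒜 \\ 𝒜, ∑ A : 𝒜, c A * ((if E ⊆ (A : Finset α) then (1 : K) else 0) +
        t * (if Disjoint E (A : Finset α) then (1 : K) else 0)) = 0)
    (x : K) (c0 : ↥𝒜 → ℚ) (hc : ∀ A : 𝒜, c A = x * ((c0 A : ℚ) : K)) : c = 0 := by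
  classical
  by_cases hx0 : x = 0
  · funext A; rw [hc A, hx0, zero_mul, Pi.zero_apply]
  by_cases hc0z : c0 = 0
  · funext A; rw [hc A, hc0z, Pi.zero_apply, Rat.cast_zero, mul_zero, Pi.zero_apply]
  exfalso
  -- casting `if` through ℚ → K
  have castite : ∀ (P : Prop) [Decidable P], (((if P then (1 : ℚ) else 0 : ℚ)) : K) = if P then (1 : K) else 0 := by
    intro P _
    split_ifs <;> simp
  -- rational column sums of c0
  let a : Finset α → ℚ := fun E => ∑ A : 𝒜, c0 A * (if E ⊆ (A : Finset α) then (1 : ℚ) else 0)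
  let b : Finset α → ℚ := fun E => ∑ A : 𝒜, c0 A * (if Disjoint E (A : Finset α) then (1 : ℚ) else 0)
  have hcast_a : ∀ E, ((a E : ℚ) : K) = ∑ A : 𝒜, ((c0 A : ℚ) : K) * (if E ⊆ (A : Finset α) then (1 : K) else 0) := by
    intro E
    simp only [a, Rat.cast_sum, Rat.cast_mul, castite]
  have hcast_b : ∀ E, ((b E : ℚ) : K) = ∑ A : 𝒜, ((c0 A : ℚ) : K) * (if Disjoint E (A : Finset α) then (1 : K) else 0) := by
    intro E
    simp only [b, Rat.cast_sum, Rat.cast_mul, castite]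
  have hab : ∀ E ∈ 𝒜 \\ 𝒜, ((a E : ℚ) : K) + t * ((b E : ℚ) : K) = 0 := by
    intro E hE
    have h := hdep E hE
    have e1 : ((a E : ℚ) : K) + t * ((b E : ℚ) : K) =
        ∑ A : 𝒜, ((c0 A : ℚ) : K) * ((if E ⊆ (A : Finset α) then (1 : K) else 0) +
          t * (if Disjoint E (A : Finset α) then (1 : K) else 0)) := by
      rw [hcast_a, hcast_b, mul_sum, ← sum_add_distrib]
      refine sum_congr rfl fun A _ => ?_
      ring
    have e2 : x * ∑ A : 𝒜, ((c0 A : ℚ) : K) * ((if E ⊆ (A : Finset α) then (1 : K) else 0) +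
          t * (if Disjoint E (A : Finset α) then (1 : K) else 0)) =
        ∑ A : 𝒜, c A * ((if E ⊆ (A : Finset α) then (1 : K) else 0) +
          t * (if Disjoint E (A : Finset α) then (1 : K) else 0)) := by
      rw [mul_sum]
      refine sum_congr rfl fun A _ => ?_
      rw [hc A]
      ring
    have h2 : x * (((a E : ℚ) : K) + t * ((b E : ℚ) : K)) = 0 := by rw [e1, e2, h]
    exact (mul_eq_zero.mp h2).resolve_left hx0
  -- Marica–Schönheim over ℚ: some column has a E ≠ 0 (since c0 ≠ 0)
  have hexists : ∃ E ∈ 𝒜 \\ 𝒜, a E ≠ 0 := by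
    by_contra hno
    refine hc0z (eq_zero_of_sum_incidence_diffs_eq_zero (K := ℚ) 𝒜 c0 fun F hF => ?_)
    by_contra haF
    exact hno ⟨F, hF, haF⟩
  obtain ⟨E, hE, haE⟩ := hexists
  have hbE : b E ≠ 0 := by
    intro hb
    have h := hab E hE
    rw [hb, Rat.cast_zero, mul_zero, add_zero] at h
    exact haE (by exact_mod_cast h)
  -- hence t is rational
  set q : ℚ := -a E / b E with hq
  have htq : t = ((q : ℚ) : K) := by
    have h := hab E hE
    have hbK : ((b E : ℚ) : K) ≠ 0 := by exact_mod_cast hbE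
    rw [hq, Rat.cast_div, Rat.cast_neg]
    field_simp
    linear_combination h
  have hq1 : q ≠ 1 := by
    intro h; apply ht1; rw [htq, h, Rat.cast_one]
  have hq2 : q ≠ -1 := by
    intro h; apply ht2; rw [htq, h, Rat.cast_neg, Rat.cast_one]
  have hdepQ : ∀ F ∈ 𝒜 \\ 𝒜, a F + q * b F = 0 := by
    intro F hF
    have h := hab F hF
    rw [htq, ← Rat.cast_mul, ← Rat.cast_add] at h
    exact_mod_cast h
  -- contradiction with the rational pencil theorem
  have hli := linearIndependent_pencil_diffs 𝒜 hq1 hq2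
  rw [Fintype.linearIndependent_iff] at hli
  refine hc0z ?_
  funext A
  refine hli c0 ?_ A
  funext F
  simp only [Finset.sum_apply, Pi.smul_apply, smul_eq_mul, Pi.zero_apply]
  have h := hdepQ F F.2
  have e : ∑ A : 𝒜, c0 A * ((if (F : Finset α) ⊆ (A : Finset α) then (1 : ℚ) else 0) +
      q * (if Disjoint (F : Finset α) (A : Finset α) then (1 : ℚ) else 0)) = a F + q * b F := by
    simp only [a, b, mul_sum, ← sum_add_distrib]
    refine sum_congr rfl fun A _ => ?_
    ring
  rw [e, h]

end OrderedDifferences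

end Summit.CriticalPhenomena.PercolationContinuityZ3.Theorems
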